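import Literature.MathematicalPhysics.QuantumFieldTheory.Balaban1983to89.Node00.Record13
import Literature.MathematicalPhysics.QuantumFieldTheory.Balaban1983to89.Node00.LargeFieldBackgroundCoOfRecord

/-!
# RECORD 13 AT PRINT'S BACKGROUND `U_k(V)` — the Co edition of the form side, the core tower ∕ datum and the core record family
# (node00-def-T FILE 21; director-ym LINE №152 RULING (β), 2026-08-27)

Bałaban's background configuration `U_k` of the k-th step ([III] (2.12)–(2.13) pp. 256–257, «U regular … see [15]») is the minimal configuration of
[15] (5) on the space (6) = `U_k({Ω_j}, ε₀) ∩ 𝔘(𝔅_k, V)`, and [6] Sect. A defines `U_k({Ω_j}, α₀)` by the conditions (1.7) AND (1.9) (p. 77).  RECORD 13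
v1.0–v1.3 (`Node00/Record13.lean`, `Node00/Record13SepMixed.lean`) typed the §2 (2.18) form, the laws 𝐒 ∕ 𝐓, the 𝐑-leaf carrier 𝐕, the residual, the
Stage-5 parameters, the Stage-13 core and hence the tower ∕ datum ∕ record at the carrier `UbgOfRecord₁₃`, whose level `n+1` is node00-def-R FILE 16's
`UbgMSOfRecord` — the minimiser over the (1.7)-ONLY class `regMSOfRecord`.  That object is ours, not print's: nothing in print or in the tree gives (1.9) for
it (node00-def-R ANSWER-151; director-ym №151∕№152), so a `bg` proviso stated at print's minimiser could never meet a form expanded at FILE 16's.  The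
director's RULING (β) (LINE №152, 2026-08-27T08:19:30Z): RECORD 13 is re-based ONCE at print's background — node00-def-R FILE 22
`Node00/LargeFieldBackgroundCoOfRecord.lean` (p512668 ✓) supplies `UbgMSCoOfRecord`, the minimiser of record over print's full class `regMSCoOfRecord`
= (1.7) ∧ (1.9), with (1.7) ∕ (1.9) AT the minimiser as properties by membership (`plaqSmallOn_ ∕ coDivClassOn_UbgMSCoOfRecord … hsol`).

THIS MODULE is that re-base for everything of RECORD 13 that reads the background and is NOT keyed on a proviso structure with a `bg` row (those —
v1.4 `Provisos₁₃SepCo` and its faces — are FILE 22T `Node00/Record13SepCo.lean`, on this module's olean).  Every declaration below is the VERBATIM image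
of a landed (or, for §3, of a staged-and-checked Core-keyed) RECORD-13 declaration under ONE uniform token rule, KEY-RULE-21:

* (R6 — the only semantic change) `UbgOfRecord₁₃ ↦ UbgOfRecord₁₃Co` (`| 0 => 𝐖 0 | n+1 => UbgMSCoOfRecord …`), i.e. inside bodies `UbgMSOfRecord ↦
  UbgMSCoOfRecord`; every statement SHAPE is preserved token for token;
* (R2) the first `₁₃` of a background-reading name ↦ `₁₃Co` (`S218OfRecord₁₃Co`, `ScorrLawOfRecord₁₃Co`, `SLaw₁₃Co`, `TLaw₁₃Co`, `sLaw₁₃Co_iff`,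
  `tLaw₁₃Co_iff`, `VOfRecord₁₃Co`, `rOpLeaf_VOfRecord₁₃Co_iff`, `Stage13Params.toStage5₁₃Co`, `coreOfRecord₁₃Co`, `sect2Form_coreOfRecord₁₃Co_iff`, …);
  (R3) names without `₁₃` but with a `stage13 ∕ Stage13` stem ↦ `…stage13Co…` (`residualOfStage13Co`, `rOperation_upOfRecord₅C_stage13Co_iff`,
  `actionSide_stage13Co`, `sect2Form_stage13Co_iff`, `effAction_succ_stage13Co`); (R1) the record-level token `₁₃C` ↦ `₁₃CCo` (`IsRecordOfRecord₁₃CCo`, …);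
* (R4) the bg-free CORE-KEYED tower ∕ datum of v1.2 (`towerOfRecord₁₃Core ∕ datumOfRecord₁₃Core`, keyed on the background-FREE proviso core
  `Stage13Params.Provisos₁₃Core`, which is UNCHANGED and cited, never twinned) have the Co twins `towerOfRecord₁₃Co ∕ datumOfRecord₁₃Co` with the SAME
  key `(h : θ.Provisos₁₃Core F N)`; the Core-keyed face family (tower ∕ datum faces, the [V] Thm 1 induction sockets `inductionBase_ ∕ inductionStep_ ∕
  thm1Printed_datumOfRecord₁₃Co_of_tLaw_rOpLeaf`, the record predicate `IsRecordOfRecord₁₃CCo` with its pointed ∕ existential faces and consequences,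
  the Stage-5 shadow `…shadow₁₃Co`, the node sockets `atWorld_ ∕ rgFlow_of_smallCouplings_ ∕ b4∕b5∕b7_main_ ∕ endStatementBPrinted_…_of_nodes ∕
  exists_beta_of_isRecordOfRecord₁₃CCo`) is §3 — so BOTH the v1.1 face `X_datumOfRecord₁₃ θ (h : Provisos₁₃)` and the v1.2 face `X_datumOfRecord₁₃Core θ
  (h : Provisos₁₃Core)` have the one image `X_datumOfRecord₁₃Co θ (h : Provisos₁₃Core)` (consumers holding v1.4 provisos pass `h.toCore`).

Background-FREE RECORD-13 declarations (`Stage13Params`, `gOfRecord₁₃`, `EOfRecord₁₃`, `densOfRecord₁₃`, `tdensOfRecord₁₃`, `WtOfRecord₁₃`,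
`settingOfRecord₁₃`, `suppOfRecord₁₃`, `betaOfRecord₁₃`, `Provisos₁₃Core` and its row lemmas, `rstep₁₃_of_…`, `avOfRecord`, …) are CITED from
`Node00/Record13.lean`, never re-declared.  The U_old objects of v1.0–v1.3 stay in the tree as pre-№152 siblings; there is NO bridge between a U_old
datum ∕ record and a Co one (different background ⇒ not statable), and NO identification of the two minimisers (two independent choices over two
classes; [15] Thm 1's uniqueness is mod gauge and is NOT asserted).

LAYOUT.  §1 `FormSideCo` — `UbgOfRecord₁₃Co` (+ `_zero ∕ _succ`), `S218OfRecord₁₃Co`, `ScorrLawOfRecord₁₃Co`, `SLaw₁₃Co ∕ TLaw₁₃Co` (+ `_iff`, `_zero`,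
`s218OfRecord₁₃Co_zero_iff`, `sLaw₁₃Co_of_forall_slot_eq_zero`), `VOfRecord₁₃Co` (+ `R_…_tdens`, `rOpLeaf_…_iff`), `residualOfStage13Co`,
`Stage13Params.toStage5₁₃Co` (+ `_res_V ∕ _res_S218 ∕ _res_βfun`), `rOperation_upOfRecord₅C_stage13Co_iff`, `coreOfRecord₁₃Co` (+ `rhoZero_`,
`sect2Form_…_iff`, `βfun_`).  §2 `CoreTowerCo` — `towerOfRecord₁₃Co`, `datumOfRecord₁₃Co` and their `rfl` faces.  §3 `CoreRecordCo` — the Core-keyed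
face family at the Co datum (R4 above).  HYP-AUDIT (refuter RECORD13-AUDIT standing rule): no hypothesis of any imaged statement is dropped, weakened or
added — binder lists are verbatim; the images are re-checked proofs, not `sorry`s, and contain no new mathematics.

HONEST FRAMING.  Definitions and verbatim-imaged bookkeeping of record; NOTHING of Bałaban is asserted ([15] Thm 1 existence ∕ uniqueness, (2.27)(iv),
hypothesis (B), [V] Thm 1 are NOT asserted — they remain hypotheses ∕ sockets exactly as in v1.2); the node item K0⁗ is NOT discharged by this file; one
finite 𝕋⁴ programme at fixed ε — NOT the continuum ∕ ℝ⁴ ∕ OS ∕ mass-gap ∕ Clay statement.  References: [III] = Balaban1988Convergent, [6] =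
Balaban1985RegularSpaces, [15] = Balaban1985Variational, [IV] = Balaban1989LargeFieldI, [V] = Balaban1989LargeFieldII, [B8] = Balaban1987RG1.
-/

noncomputable section

open MeasureTheory
open scoped Matrix.Norms.L2Operator

namespace Literature.MathematicalPhysics.QuantumFieldTheory.Balaban1983to89.Node00

open T4Continuum AveragingRT T4FiniteEpsInhabited FlowStep FlowStepRuns DagBinding T4DatumAssembly
open B12Eq019ActionBody (integrand)

variable (F : T4Family) (N : ℕ) [NeZero N]

/-! ## §1 (Co). THE BACKGROUND OF RECORD AT PRINT'S CLASS and the Co image of the §2–§8 form side of RECORD 13: (2.18) form, laws 𝐒∕𝐓, 𝐕, residual,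
Stage-5 parameters, the Stage-13 core — every statement VERBATIM from `Node00/Record13.lean` v1.2 under KEY-RULE-21 -/

section FormSideCo

/-- **THE BACKGROUND MAPS OF RECORD, Stage 13** — FILE 12b's two-case carrier along the ₁₃ history: level 0 the print's `U₀(𝐖) := 𝐖 0`, level `n+1` def-R's
`UbgMSCoOfRecord` (print's multi-scale class). [cite: Balaban1988Convergent, Thm 1 p.262, (2.12)–(2.13) pp.256–257; Balaban1985AveragingOps, (6)∕(8) p.278] -/
def UbgOfRecord₁₃Co (θ : Stage13Params F N) (p : B12.RunParams) :
    (n : ℕ) → (SeqOfRecord F θ.ν θ.τ9.M (gOfRecord₁₃ F N θ p) p.K n → BgMap F N p.K)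
  | 0 => fun _ W => W 0
  | n + 1 => UbgMSCoOfRecord F N θ.ν θ.τ9.M (gOfRecord₁₃ F N θ p) p.K (n + 1)

/-- LEVEL 0: the background map of record IS the scale-0 field (`rfl`). [cite: Balaban1988Convergent, Thm 1 p.262] -/
theorem UbgOfRecord₁₃Co_zero (θ : Stage13Params F N) (p : B12.RunParams) : UbgOfRecord₁₃Co F N θ p 0 = fun _ W => W 0 := rfl

/-- LEVEL `n + 1`: def-R's multi-scale background map of record (`rfl`). [cite: Balaban1988Convergent, (2.12)–(2.13) pp.256–257] -/
theorem UbgOfRecord₁₃Co_succ (θ : Stage13Params F N) (p : B12.RunParams) (n : ℕ) :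
    UbgOfRecord₁₃Co F N θ p (n + 1) = UbgMSCoOfRecord F N θ.ν θ.τ9.M (gOfRecord₁₃ F N θ p) p.K (n + 1) := rfl

/-- **THE §2 [III] FORMAT PREDICATE OF RECORD, Stage 13** for step-`j` densities of the run `p`: represented by `rep_j` of record AND the post-𝐑 slot family of record
has the REPAIRED §2 form at index `j` — at the ₁₃ setting, weights, background maps and slots. [cite: Balaban1988Convergent, (2.17)–(2.18) p.257, (2.23)–(2.42) pp.258–261, Thm 1 p.262] -/
def S218OfRecord₁₃Co (θ : Stage13Params F N) (p : B12.RunParams) (j : ℕ) (σ : Density (F.P p.K) j (SU N)) : Prop :=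
  (reprOfRecord₁₃ F N θ p j).Holds σ ∧
    HasSect2FormAEZ F N (FluctV N) p.K (settingOfRecord₁₃ F N θ p) (θ.Rz p.K) (WtOfRecord₁₃ F N θ p) j
      (UbgOfRecord₁₃Co F N θ p j)
      (slotsOfRecord F N θ.ν θ.τ9 (EOfRecord₁₃ F N θ) (wOfRecord₉ F N θ.toStage9Params) θ.ppSel p
        (gOfRecord₁₃ F N θ p) j)

/-- **THE «CORRESPONDING SPACE» PREDICATE OF RECORD, Stage 13** for the 𝐓-image at step `k+1`. [cite: Balaban1988Convergent, remark p.262, Def. p.279, (3.25) p.270] -/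
def ScorrLawOfRecord₁₃Co (θ : Stage13Params F N) (p : B12.RunParams) (k : ℕ) (σ' : Density (F.P p.K) (k + 1) (SU N)) : Prop :=
  (reprTOfRecord₁₃ F N θ p k).Holds σ' ∧
    HasSect2FormTAEZ F N (FluctV N) p.K (settingOfRecord₁₃ F N θ p) (θ.Rz p.K) (WtOfRecord₁₃ F N θ p) k
      (UbgOfRecord₁₃Co F N θ p (k + 1))
      (slotsTOfRecord F N θ.ν θ.τ9 (EOfRecord₁₃ F N θ) (wOfRecord₉ F N θ.toStage9Params) θ.ppSel p
        (gOfRecord₁₃ F N θ p) (k + 1))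

/-- **`SLaw₁₃Co θ p j`** — `S218OfRecord₁₃Co` READ AT `densOfRecord₁₃`. [cite: Balaban1988Convergent, (2.18) p.257, Thm 1 p.262] -/
def SLaw₁₃Co (θ : Stage13Params F N) (p : B12.RunParams) (j : ℕ) : Prop :=
  S218OfRecord₁₃Co F N θ p j (densOfRecord₁₃ F N θ p j)

/-- **`TLaw₁₃Co θ p k`** — `ScorrLawOfRecord₁₃Co` READ AT `tdensOfRecord₁₃`. [cite: Balaban1988Convergent, remark p.262, Def. p.279] -/
def TLaw₁₃Co (θ : Stage13Params F N) (p : B12.RunParams) (k : ℕ) : Prop :=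
  ScorrLawOfRecord₁₃Co F N θ p k (tdensOfRecord₁₃ F N θ p k)

/-- `SLaw₁₃Co` IS the repaired §2 form of the post-𝐑 slot family (the representation clause holds by construction). [cite: Balaban1988Convergent, (2.18) p.257, Thm 1 p.262] -/
theorem sLaw₁₃Co_iff (θ : Stage13Params F N) (p : B12.RunParams) (j : ℕ) :
    SLaw₁₃Co F N θ p j ↔ HasSect2FormAEZ F N (FluctV N) p.K (settingOfRecord₁₃ F N θ p) (θ.Rz p.K) (WtOfRecord₁₃ F N θ p) j
      (UbgOfRecord₁₃Co F N θ p j)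
      (slotsOfRecord F N θ.ν θ.τ9 (EOfRecord₁₃ F N θ) (wOfRecord₉ F N θ.toStage9Params) θ.ppSel p
        (gOfRecord₁₃ F N θ p) j) :=
  ⟨fun h => h.2, fun h => ⟨holds_densOfRecord₁₃ F N θ p j, h⟩⟩

/-- `TLaw₁₃Co` IS the repaired 𝐓-image form of the pre-𝐑 slot family. [cite: Balaban1988Convergent, remark p.262, (3.25) p.270] -/
theorem tLaw₁₃Co_iff (θ : Stage13Params F N) (p : B12.RunParams) (k : ℕ) :
    TLaw₁₃Co F N θ p k ↔ HasSect2FormTAEZ F N (FluctV N) p.K (settingOfRecord₁₃ F N θ p) (θ.Rz p.K) (WtOfRecord₁₃ F N θ p) k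
      (UbgOfRecord₁₃Co F N θ p (k + 1))
      (slotsTOfRecord F N θ.ν θ.τ9 (EOfRecord₁₃ F N θ) (wOfRecord₉ F N θ.toStage9Params) θ.ppSel p
        (gOfRecord₁₃ F N θ p) (k + 1)) :=
  ⟨fun h => h.2, fun h => ⟨holds_tdensOfRecord₁₃ F N θ p k, h⟩⟩

/-- **THE BASE IS A THEOREM** at Stage 13: the level-0 post-𝐑 slot family HAS the repaired §2 form for EVERY `θ` and run — n13-e's GENERIC
`hasSect2FormAE_zero_of_bg_readsScaleZero` (any setting whose flow starts at `g 0`, any background map reading the scale-0 variables), identity branch.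
[cite: Balaban1988Convergent, Thm 1 p.262, (2.18) p.257, (2.23)–(2.24) pp.258–259] -/
theorem sLaw₁₃Co_zero (θ : Stage13Params F N) (p : B12.RunParams) : SLaw₁₃Co F N θ p 0 :=
  (sLaw₁₃Co_iff F N θ p 0).mpr
    (B16Thm1BaseAtRecord11.hasSect2FormAE_zero_of_bg_readsScaleZero F N (FluctV N) p (settingOfRecord₁₃ F N θ p) (θ.Rz p.K)
      (WtOfRecord₁₃ F N θ p) θ.ν θ.τ9 (EOfRecord₁₃ F N θ) (wOfRecord₉ F N θ.toStage9Params) θ.ppSel rfl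
      (U := UbgOfRecord₁₃Co F N θ p 0) (fun _ _ => rfl)).toZ

/-- … so at level 0 the format predicate of record IS the representation clause. [cite: Balaban1988Convergent, Thm 1 p.262, (2.18) p.257 (bookkeeping)] -/
theorem s218OfRecord₁₃Co_zero_iff (θ : Stage13Params F N) (p : B12.RunParams) (σ : Density (F.P p.K) 0 (SU N)) :
    S218OfRecord₁₃Co F N θ p 0 σ ↔ (reprOfRecord₁₃ F N θ p 0).Holds σ :=
  ⟨fun h => h.1, fun h => ⟨h, (sLaw₁₃Co_zero F N θ p).2⟩⟩

/-- **ABSENT SLOTS PASS**: if every post-𝐑 slot of record at level `j` is the zero function, `SLaw₁₃Co θ p j` holds under the signs `0 ≤ E₀, B₀` and a nonnegative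
history up to `j`. [cite: Balaban1988Convergent, (2.17) p.257; Balaban1987RG1, (0.20) p.256] -/
theorem sLaw₁₃Co_of_forall_slot_eq_zero (θ : Stage13Params F N) (p : B12.RunParams) (j : ℕ)
    (h0 : ∀ s, slotsOfRecord F N θ.ν θ.τ9 (EOfRecord₁₃ F N θ) (wOfRecord₉ F N θ.toStage9Params) θ.ppSel p
      (gOfRecord₁₃ F N θ p) j s = 0)
    (hE₀ : 0 ≤ θ.s2.lf.E₀) (hB₀ : 0 ≤ θ.s2.lf.B₀) (hg : ∀ i, i ≤ j → 0 ≤ gOfRecord₁₃ F N θ p i) : SLaw₁₃Co F N θ p j :=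
  (sLaw₁₃Co_iff F N θ p j).mpr
    (hasSect2FormAEZ_of_forall_eq_zero p.K _ _ _ j _ h0 (settingOfRecord₁₃_satisfiesRG F N θ p j) hE₀ hB₀ hg)

/-- **THE 𝐑-CARRIERS OF THE RUN `p`, Stage 13**: target space `S j ρ :↔ ρ = ρ_j ∧ SLaw₁₃Co θ p j`, corresponding space `Scorr (k+1) ρ' :↔ ρ' = 𝐓ρ_k ∧ TLaw₁₃Co θ p k`,
`Scorr 0 :≡ ⊥`, induced `R`. [cite: Balaban1988Convergent, p.244 and remark p.262; Balaban1989LargeFieldI, (0.2)–(0.3) p.176] -/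
def VOfRecord₁₃Co (θ : Stage13Params F N) (p : B12.RunParams) : PrintedCarriers14R where
  P := F.P p.K
  G := SU N
  instGG := inferInstance
  instMS := inferInstance
  instHD := inferInstance
  K := p.K
  R := fun k => inducedAt (tdensOfRecord₁₃ F N θ p k) (densOfRecord₁₃ F N θ p (k + 1))
  Scorr := fun j ρ' => match j with
    | 0 => False
    | k + 1 => ρ' = tdensOfRecord₁₃ F N θ p k ∧ TLaw₁₃Co F N θ p k
  S := fun j ρ => ρ = densOfRecord₁₃ F N θ p j ∧ SLaw₁₃Co F N θ p j

/-- The pinned density operation maps `𝐓ρ_k ↦ ρ_{k+1}`. [cite: Balaban1989LargeFieldI, (0.2)–(0.3) p.176 (bookkeeping)] -/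
theorem R_VOfRecord₁₃Co_tdens (θ : Stage13Params F N) (p : B12.RunParams) (k : ℕ) :
    (VOfRecord₁₃Co F N θ p).R k (tdensOfRecord₁₃ F N θ p k) = densOfRecord₁₃ F N θ p (k + 1) :=
  inducedAt_self _ _

/-- **[III] p. 244's LEAF AT THE STAGE-13 CARRIERS**: `ROpLeaf (VOfRecord₁₃Co θ p) ↔ ∀ k < K, TLaw₁₃Co θ p k → SLaw₁₃Co θ p (k+1)`.
[cite: Balaban1988Convergent, p.244, Thm 2 p.263 and remark p.262 (bookkeeping)] -/
theorem rOpLeaf_VOfRecord₁₃Co_iff (θ : Stage13Params F N) (p : B12.RunParams) :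
    ROpLeaf (VOfRecord₁₃Co F N θ p) ↔ ∀ k, k < p.K → TLaw₁₃Co F N θ p k → SLaw₁₃Co F N θ p (k + 1) := by
  rw [rOpLeaf_iff]
  refine ⟨fun h k hk hT => ?_, fun h k hk ρ' hρ' => ?_⟩
  · have hS := h k hk (tdensOfRecord₁₃ F N θ p k) ⟨rfl, hT⟩
    rw [R_VOfRecord₁₃Co_tdens] at hS
    exact hS.2
  · obtain ⟨rfl, hT⟩ := hρ'
    show (VOfRecord₁₃Co F N θ p).S (k + 1) ((VOfRecord₁₃Co F N θ p).R k (tdensOfRecord₁₃ F N θ p k))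
    rw [R_VOfRecord₁₃Co_tdens]
    exact ⟨rfl, h k hk hT⟩

/-- **THE STAGE-13 RESIDUAL**: Stage 8's residual with the 𝐑-carriers `VOfRecord₁₃Co`, the β RE-POINT `βfun := betaOfRecord₁₃` (the χ-generic β at `TcanOfRecord` and the
(2.9) species), `E`, `χ := chiβOfRecord₁₃ θ` along `gOfRecord₁₃`, the four action∕format fields over def-B's transport-generic layer AT `TβOfRecord₁₃ = TcanOfRecord`
and `chiβOfRecord₁₃ θ`, and `S218 := S218OfRecord₁₃Co` PINNED.
[cite: Balaban1988Convergent, p.244, (2.18) p.257; Balaban1989LargeFieldI, (0.2)–(0.6) pp.176–177; Balaban1987RG1, (0.19) p.255, p.259 (dictionary; bookkeeping)] -/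
def residualOfStage13Co (θ : Stage13Params F N) : Residual₅ F N :=
  { residualOfStage8 F N θ.toStage8Params with
    V := VOfRecord₁₃Co F N θ
    βfun := betaOfRecord₁₃ F N θ
    χ := fun p k => chiβOfRecord₁₃ F N θ p.K (gOfRecord₁₃ F N θ p) k
    E := EOfRecord₁₃ F N θ
    effAction := effActionOfRecordT F N (TβOfRecord₁₃ F N) (chiβOfRecord₁₃ F N θ) (betaOfRecord₁₃ F N θ)
    Ek := EkOfRecordT F N (TβOfRecord₁₃ F N) (chiβOfRecord₁₃ F N θ) θ.εbg (betaOfRecord₁₃ F N θ)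
    ReprA := ReprAOfRecordT F N (TβOfRecord₁₃ F N) (chiβOfRecord₁₃ F N θ) θ.εbg (betaOfRecord₁₃ F N θ)
    IndA := IndAOfRecordT F N (TβOfRecord₁₃ F N) (chiβOfRecord₁₃ F N θ) θ.εbg (betaOfRecord₁₃ F N θ)
    S218 := S218OfRecord₁₃Co F N θ }

/-- **The Stage-5 VIEW of Stage-13 parameters, Stage-13 residual**. [cite: Balaban1989LargeFieldII, Thm 1 p.355 (bookkeeping)] -/
def Stage13Params.toStage5₁₃Co (θ : Stage13Params F N) : Stage5Params F N :=
  { θ.toStage5Params with res := residualOfStage13Co F N θ }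

/-- The view's 𝐑-carriers ARE the pinned ones (`rfl`). [cite: Balaban1988Convergent, p.244 (bookkeeping)] -/
theorem Stage13Params.toStage5₁₃Co_res_V (θ : Stage13Params F N) (p : B12.RunParams) : (θ.toStage5₁₃Co F N).res.V p = VOfRecord₁₃Co F N θ p := rfl

/-- The view's format slot IS the Stage-13 predicate of record (`rfl`). [cite: Balaban1988Convergent, (2.18) p.257 (bookkeeping)] -/
theorem Stage13Params.toStage5₁₃Co_res_S218 (θ : Stage13Params F N) : (θ.toStage5₁₃Co F N).res.S218 = S218OfRecord₁₃Co F N θ := rfl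

/-- The view's β-functions ARE `betaOfRecord₁₃ θ` (`rfl`). [cite: Balaban1987RG1, (1.20)–(1.22) p.264 (bookkeeping)] -/
theorem Stage13Params.toStage5₁₃Co_res_βfun (θ : Stage13Params F N) : (θ.toStage5₁₃Co F N).res.βfun = betaOfRecord₁₃ F N θ := rfl

/-- **THE RECORD'S 𝐑-LEAF, UNFOLDED** at the C-binding of record over the Stage-13 view. [cite: Balaban1988Convergent, p.244 and Thm 2 p.263; Balaban1989LargeFieldII, Thm 1 p.355 (bookkeeping)] -/
theorem rOperation_upOfRecord₅C_stage13Co_iff (θ : Stage13Params F N) (p : B12.RunParams) :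
    (upOfRecord₅C F N (θ.toStage5₁₃Co F N) p).rOperation ↔ ∀ k, k < p.K → TLaw₁₃Co F N θ p k → SLaw₁₃Co F N θ p (k + 1) := by
  show ROpLeaf (VOfRecord₁₃Co F N θ p) ↔ _
  exact rOpLeaf_VOfRecord₁₃Co_iff F N θ p

/-- **THE CORE OF RECORD at `θ`, Stage 13** (`RGMachineCore`, by hand, as FILE 10's `coreOfRecord₁₀` with `TcOfRecord ↦ TβOfRecord₁₃ = TcanOfRecord`, `chiFixed7 ↦ chiβOfRecord₁₃ θ = chiFixed29 θ.ν θ.ε₂₉` and the ₁₃ plugs):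
`Sect2Form p k := S218OfRecord₁₃Co θ p k ρ_k` READ AT `densOfRecord₁₃`. [cite: Balaban1987RG1, (0.17)–(0.24) pp.255–257, p.259; Balaban1988Convergent, (2.17)–(2.18) p.257, Thm 1 p.262 (dictionary; bookkeeping)] -/
def coreOfRecord₁₃Co (θ : Stage13Params F N) : RGMachineCore F (SU N) where
  βfun := betaOfRecord₁₃ F N θ
  E := EOfRecord₁₃ F N θ
  dom := fun p k => domAltOfRecord F N θ.ν p.K k
  effAction := effActionOfRecordT F N (TβOfRecord₁₃ F N) (chiβOfRecord₁₃ F N θ) (betaOfRecord₁₃ F N θ)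
  wilsonBG := wilsonBGOfRecord F N θ.εbg
  Ek := EkOfRecordT F N (TβOfRecord₁₃ F N) (chiβOfRecord₁₃ F N θ) θ.εbg (betaOfRecord₁₃ F N θ)
  χ := fun p k => chiβOfRecord₁₃ F N θ p.K (gOfRecord₁₃ F N θ p) k
  Repr := fun p k => ReprAOfRecordT F N (TβOfRecord₁₃ F N) (chiβOfRecord₁₃ F N θ) θ.εbg (betaOfRecord₁₃ F N θ) p k
    (prefixOf (gOfRecord₁₃ F N θ p) k) (domAltOfRecord F N θ.ν p.K k)
    (effActionOfRecordT F N (TβOfRecord₁₃ F N) (chiβOfRecord₁₃ F N θ) (betaOfRecord₁₃ F N θ) p k)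
    (wilsonBGOfRecord F N θ.εbg p k) (EkOfRecordT F N (TβOfRecord₁₃ F N) (chiβOfRecord₁₃ F N θ) θ.εbg (betaOfRecord₁₃ F N θ) p k)
  IndAss := fun p k => IndAOfRecordT F N (TβOfRecord₁₃ F N) (chiβOfRecord₁₃ F N θ) θ.εbg (betaOfRecord₁₃ F N θ) p k
    (prefixOf (gOfRecord₁₃ F N θ p) k) (domAltOfRecord F N θ.ν p.K k)
    (effActionOfRecordT F N (TβOfRecord₁₃ F N) (chiβOfRecord₁₃ F N θ) (betaOfRecord₁₃ F N θ) p k)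
    (wilsonBGOfRecord F N θ.εbg p k) (EkOfRecordT F N (TβOfRecord₁₃ F N) (chiβOfRecord₁₃ F N θ) θ.εbg (betaOfRecord₁₃ F N θ) p k)
  Sect2Form := fun p k => S218OfRecord₁₃Co F N θ p k (densOfRecord₁₃ F N θ p k)

/-- The core's Wilson start IS `ρ₀` of record. [cite: Balaban1988Convergent, Thm 1 p.262 (bookkeeping)] -/
theorem rhoZero_coreOfRecord₁₃Co (θ : Stage13Params F N) (p : B12.RunParams) :
    (coreOfRecord₁₃Co F N θ).rhoZero p = densOfRecord₁₃ F N θ p 0 := by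
  rw [densOfRecord₁₃_zero]
  rfl

/-- The core's §2 clause IS `SLaw₁₃Co` (`Iff.rfl`). [cite: Balaban1988Convergent, (2.18) p.257, Thm 1 p.262 (bookkeeping)] -/
theorem sect2Form_coreOfRecord₁₃Co_iff (θ : Stage13Params F N) (p : B12.RunParams) (k : ℕ) :
    (coreOfRecord₁₃Co F N θ).Sect2Form p k ↔ SLaw₁₃Co F N θ p k := Iff.rfl

/-- The core's β IS the χ-generic β at the canonical-version transport and the (2.9) species (`rfl`). [cite: Balaban1987RG1, (1.20)–(1.22) p.264 (bookkeeping)] -/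
theorem βfun_coreOfRecord₁₃Co (θ : Stage13Params F N) :
    (coreOfRecord₁₃Co F N θ).βfun = betaOfRecord₈Tχ F N (TcanOfRecord F N) (chiFixed29 F N θ.ν θ.ε₂₉) θ.toStage8Params := rfl

end FormSideCo

/-! ## §2 (Co). THE bg-FREE CORE TOWER ∕ DATUM AT PRINT'S BACKGROUND — keyed on the UNCHANGED background-free `Provisos₁₃Core` of v1.2; rfl faces -/

section CoreTowerCo

open Classical in
/-- **THE TOWER OF RECORD at `θ` keyed on the bg-free CORE, AT PRINT'S BACKGROUND** (Co twin of v1.2's `towerOfRecord₁₃Core`), BY HAND exactly as it (which reads `h` only through `tstep` ∕ `rstep`).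
[cite: Balaban1988Convergent, (0.2) p.244, (2.18) p.257, (3.25) p.270; Balaban1989LargeFieldI, (0.4) p.176] -/
def towerOfRecord₁₃Co (θ : Stage13Params F N) (h : θ.Provisos₁₃Core F N) : (coreOfRecord₁₃Co F N θ).Tower (avOfRecord F N) where
  ρ := fun p k => densOfRecord₁₃ F N θ p k
  Trho := fun p k => tdensOfRecord₁₃ F N θ p k
  rho_zero := fun p => (rhoZero_coreOfRecord₁₃Co F N θ p).symm
  isRT_Trho := fun p k hk => isRT_trhoOfRecord9 F N θ.ν θ.τ9 (EOfRecord₁₃ F N θ) (wOfRecord₉ F N θ.toStage9Params) θ.ppSel p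
    (gOfRecord₁₃ F N θ p) k hk (h.tstep p k hk)
  integral_succ := fun p k hk => integral_densOfRecord₁₃_succ F N θ p k (h.rstep p k hk)

/-- **THE DATUM OF RECORD keyed on the bg-free CORE, Stage 13, AT PRINT'S BACKGROUND** (Co twin of v1.2's `datumOfRecord₁₃Core`). [cite: Balaban1989LargeFieldII, Thm 1 + (0.1) pp.355–356; Balaban1988Convergent, (0.2) p.244] -/
def datumOfRecord₁₃Co (θ : Stage13Params F N) (h : θ.Provisos₁₃Core F N) : FiniteEpsData F (SU N) :=
  datumOfTower F N (coreOfRecord₁₃Co F N θ) (towerOfRecord₁₃Co F N θ h)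

/-- FACE `dens` of the core-keyed Co datum (`rfl`). [cite: Balaban1988Convergent, (2.18) p.257 (bookkeeping)] -/
theorem dens_datumOfRecord₁₃Co (θ : Stage13Params F N) (h : θ.Provisos₁₃Core F N) (K : ℕ) (g₀ : ℝ) (k : ℕ) :
    (datumOfRecord₁₃Co F N θ h).dens K g₀ k = densOfRecord₁₃ F N θ ⟨K, F.m, g₀⟩ k := rfl

/-- FACE construction of the core-keyed Co datum (`rfl`). [cite: Balaban1989LargeFieldII, Thm 1 + (0.1) pp.355–356 (bookkeeping)] -/
theorem datumOfRecord₁₃Co_C (θ : Stage13Params F N) (h : θ.Provisos₁₃Core F N) :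
    (datumOfRecord₁₃Co F N θ h).C = (coreOfRecord₁₃Co F N θ).construction (densOfRecord₁₃ F N θ) := rfl

/-- FACE β of the core-keyed Co datum (`rfl`). [cite: Balaban1987RG1, (1.20)–(1.22) p.264 (bookkeeping)] -/
theorem βfun_datumOfRecord₁₃Co (θ : Stage13Params F N) (h : θ.Provisos₁₃Core F N) :
    (datumOfRecord₁₃Co F N θ h).βfun = betaOfRecord₁₃ F N θ := rfl

/-- FACE flow of the core-keyed Co datum (`rfl`). [cite: Balaban1987RG1, (0.17)–(0.20) pp.255–256 (bookkeeping)] -/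
theorem flow_g_datumOfRecord₁₃Co (θ : Stage13Params F N) (h : θ.Provisos₁₃Core F N) (p : B12.RunParams) :
    ((datumOfRecord₁₃Co F N θ h).C p).flow.g = gOfRecord₁₃ F N θ p := rfl

/-- FACE av of the core-keyed Co datum (`rfl`). [cite: Balaban1987RG1, (0.4) p.253 (bookkeeping)] -/
theorem av_datumOfRecord₁₃Co (θ : Stage13Params F N) (h : θ.Provisos₁₃Core F N) : (datumOfRecord₁₃Co F N θ h).av = avOfRecord F N := rfl

/-- STAGE-0 DATUM CLAUSE at the core-keyed Co datum (`rfl`). [cite: Balaban1987RG1, (0.3)–(0.4) p.253] -/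
theorem isDatumOfRecord₀_datumOfRecord₁₃Co (θ : Stage13Params F N) (h : θ.Provisos₁₃Core F N) :
    IsDatumOfRecord₀ F N (datumOfRecord₁₃Co F N θ h) := rfl

/-- BINDER B1 = NODE N23 at the core-keyed Co datum. [cite: Balaban1987RG1, (0.4) p.253] -/
theorem isPrintedAveraged_datumOfRecord₁₃Co (θ : Stage13Params F N) (h : θ.Provisos₁₃Core F N) : (datumOfRecord₁₃Co F N θ h).IsPrintedAveraged :=
  isPrintedAveraged_datumOfTower F N _ _

end CoreTowerCo

/-! ## §3 (Co). THE CORE RECORD FAMILY AT PRINT'S BACKGROUND (bg-free): tower ∕ datum faces, [V] Thm 1 induction sockets, the record predicate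
`IsRecordOfRecord₁₃CCo`, its consequences, the Stage-5 shadow, the node sockets — the Co image of the Core-keyed face family (KEY-RULE-21 R4) -/

section CoreRecordCo

variable {F N}

/-- (Co · bg-FREE PROVISO CORE) **NON-VACUITY OF THE SPACES OF RECORD AT THE RECORD, IN THE WINDOW**, Stage 13 (11c's `Sect2.one_mem_spaceI`; radii by `alphaPos₁₂_of_window`).
[cite: Balaban1987RG1, (1.11)–(1.16) p.262; Balaban1988Convergent, (2.28) p.259] -/
theorem one_mem_spaceI_stage13Co {θ : Stage13Params F N} (h : θ.Provisos₁₃Core F N) (hθ : θ.Admissible F N) (p : B12.RunParams) (j : ℕ) (Y : Set (Site (F.P p.K) 0))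
    (hw : 0 < gOfRecord₁₃ F N θ p j ∧ gOfRecord₁₃ F N θ p j ≤ θ.γ) :
    Sect2.ofBackgroundC (ιSU N) (1 : GaugeField (F.P p.K) 0 (SU N)) ∈
      Sect2.spaceI (settingOfRecord₁₃ F N θ p) (θ.Rz p.K) θ.τ9.M j Y ((lfOfRecord₁₂ F N θ.toStage12Params).alpha0 (gOfRecord₁₃ F N θ p j))
        ((lfOfRecord₁₂ F N θ.toStage12Params).alpha1 (gOfRecord₁₃ F N θ p j)) :=
  Sect2.one_mem_spaceI (settingOfRecord₁₃ F N θ p) hθ.1.pos.1 (h.rzLaws p.K) θ.τ9.M j Y (alphaPos₁₂_of_window hθ.1 hw.1 hw.2).1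
    (alphaPos₁₂_of_window hθ.1 hw.1 hw.2).2

/-- (Co · bg-FREE PROVISO CORE) … and in `Ũ^c_j(X, α̃₀, α̃₁)` of record along the sequence's large-field regions, GIVEN positive radii at every level. [cite: Balaban1988Convergent, (2.34)–(2.39) p.261] -/
theorem one_mem_spaceMS_stage13Co {θ : Stage13Params F N} (h : θ.Provisos₁₃Core F N) (hθ : θ.Admissible F N) (p : B12.RunParams) (j : ℕ) (Y : Set (Site (F.P p.K) 0))
    (Ω : ℕ → Set (Site (F.P p.K) 0))
    (hα : ∀ n, 0 < (lfOfRecord₁₂ F N θ.toStage12Params).alpha0 (gOfRecord₁₃ F N θ p n) ∧ 0 < (lfOfRecord₁₂ F N θ.toStage12Params).alpha1 (gOfRecord₁₃ F N θ p n)) :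
    Sect2.ofBackgroundC (ιSU N) (1 : GaugeField (F.P p.K) 0 (SU N)) ∈ Sect2.spaceMS (settingOfRecord₁₃ F N θ p) (θ.Rz p.K) θ.τ9.M j Y Ω :=
  Sect2.one_mem_spaceMS (settingOfRecord₁₃ F N θ p) (settingOfRecord₁₃_pos F N θ hθ.1.pos p) (h.rzLaws p.K) θ.τ9.M j Y Ω (fun n => (hα n).1) (fun n => (hα n).2)

variable (F N)

/-- (Co · bg-FREE PROVISO CORE) The tower's densities ARE `densOfRecord₁₃` (`rfl`). [cite: Balaban1988Convergent, (2.18) p.257 (bookkeeping)] -/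
theorem towerOfRecord₁₃Co_ρ (θ : Stage13Params F N) (h : θ.Provisos₁₃Core F N) (p : B12.RunParams) (k : ℕ) :
    (towerOfRecord₁₃Co F N θ h).ρ p k = densOfRecord₁₃ F N θ p k := rfl

/-- (Co · bg-FREE PROVISO CORE) The tower's `𝐓ρ_k` ARE `tdensOfRecord₁₃` (`rfl`). [cite: Balaban1988Convergent, (3.25) p.270 (bookkeeping)] -/
theorem towerOfRecord₁₃Co_Trho (θ : Stage13Params F N) (h : θ.Provisos₁₃Core F N) (p : B12.RunParams) (k : ℕ) :
    (towerOfRecord₁₃Co F N θ h).Trho p k = tdensOfRecord₁₃ F N θ p k := rfl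

/-- (Co · bg-FREE PROVISO CORE) `ρ₀` of the tower is integrable on every run: `e^{−E(p)}` times the Wilson–Boltzmann weight (`Missing.integrable_boltzmann`). [cite: Balaban1988Convergent, Thm 1 p.262 (bookkeeping)] -/
theorem integrable_towerOfRecord₁₃Co_ρ_zero (θ : Stage13Params F N) (h : θ.Provisos₁₃Core F N) (p : B12.RunParams) :
    Integrable ((towerOfRecord₁₃Co F N θ h).ρ p 0) (fieldMeasure (F.P p.K) 0 (SU N)) := by
  rw [(towerOfRecord₁₃Co F N θ h).rho_zero p]
  exact (Missing.integrable_boltzmann RegularGaugeGroup.measurable_reTr (F.P p.K) (sq_nonneg _)).const_mul _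

open Classical in
/-- (Co · bg-FREE PROVISO CORE) `ρ_{k+1}` of the tower is integrable, `k < K`: the (0.3)-density of the R-stepped pre-𝐑 slot under the integrable-form `rstep` (def-R's
`integrable_densityOfSlice_rstepSlotOfRecord_of_provisosInt`). [cite: Balaban1989LargeFieldI, (0.3)–(0.4) p.176 (bookkeeping)] -/
theorem integrable_towerOfRecord₁₃Co_ρ_succ (θ : Stage13Params F N) (h : θ.Provisos₁₃Core F N) (p : B12.RunParams) (k : ℕ) (hk : k < p.K) :
    Integrable ((towerOfRecord₁₃Co F N θ h).ρ p (k + 1)) (fieldMeasure (F.P p.K) (k + 1) (SU N)) := by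
  rw [towerOfRecord₁₃Co_ρ, densOfRecord₁₃_succ]
  exact integrable_densityOfSlice_rstepSlotOfRecord_of_provisosInt F N θ.ν θ.τ9 _ θ.ppSel p _ (k + 1) (h.rstep p k hk)

/-- (Co · bg-FREE PROVISO CORE) **THE TOWER OF RECORD IS INTEGRABLE** (`RGMachineCore.Tower.IsIntegrable`): every `ρ_k`, `k ≤ K`, from the displayed provisos alone. [cite: Balaban1988Convergent, (0.2) p.244 (bookkeeping)] -/
theorem isIntegrable_towerOfRecord₁₃Co (θ : Stage13Params F N) (h : θ.Provisos₁₃Core F N) : (towerOfRecord₁₃Co F N θ h).IsIntegrable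
  | p, 0, _ => integrable_towerOfRecord₁₃Co_ρ_zero F N θ h p
  | p, k + 1, hk => integrable_towerOfRecord₁₃Co_ρ_succ F N θ h p k (Nat.lt_of_succ_le hk)

/-- (Co · bg-FREE PROVISO CORE) … and every `𝐓ρ_k`, `k < K`, is integrable (def-T's `integrable_piece_trhoOfRecord9` summed). [cite: Balaban1988Convergent, (3.25) p.270 (bookkeeping)] -/
theorem integrable_towerOfRecord₁₃Co_Trho (θ : Stage13Params F N) (h : θ.Provisos₁₃Core F N) (p : B12.RunParams) (k : ℕ) (hk : k < p.K) :
    Integrable ((towerOfRecord₁₃Co F N θ h).Trho p k) (fieldMeasure (F.P p.K) (k + 1) (SU N)) :=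
  integrable_finsetSum Finset.univ (fun s' _ => integrable_piece_trhoOfRecord9 F N θ.ν θ.τ9 (EOfRecord₁₃ F N θ) (wOfRecord₉ F N θ.toStage9Params)
    θ.ppSel p (gOfRecord₁₃ F N θ p) k hk (h.tstep p k hk) s')

/-- (Co · bg-FREE PROVISO CORE) FACE `Trho` (`rfl`). [cite: Balaban1988Convergent, (3.25) p.270 (bookkeeping)] -/
theorem trho_datumOfRecord₁₃Co (θ : Stage13Params F N) (h : θ.Provisos₁₃Core F N) (K : ℕ) (g₀ : ℝ) (k : ℕ) :
    (datumOfRecord₁₃Co F N θ h).real.Trho K g₀ k = tdensOfRecord₁₃ F N θ ⟨K, F.m, g₀⟩ k := rfl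

/-- (Co · bg-FREE PROVISO CORE) FACE `𝐑` (`rfl`). [cite: Balaban1989LargeFieldI, (0.2)–(0.3) p.176 (bookkeeping)] -/
theorem R_datumOfRecord₁₃Co_eq_VOfRecord₁₃Co (θ : Stage13Params F N) (h : θ.Provisos₁₃Core F N) (K : ℕ) (g₀ : ℝ) (k : ℕ) :
    (datumOfRecord₁₃Co F N θ h).real.R K g₀ k = (VOfRecord₁₃Co F N θ ⟨K, F.m, g₀⟩).R k := rfl

/-- (Co · bg-FREE PROVISO CORE) … and maps `𝐓ρ_k ↦ ρ_{k+1}`. [cite: Balaban1988Convergent, (0.2) p.244; Balaban1989LargeFieldI, (0.3) p.176] -/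
theorem R_tdens_datumOfRecord₁₃Co (θ : Stage13Params F N) (h : θ.Provisos₁₃Core F N) (K : ℕ) (g₀ : ℝ) (k : ℕ) :
    (datumOfRecord₁₃Co F N θ h).real.R K g₀ k (tdensOfRecord₁₃ F N θ ⟨K, F.m, g₀⟩ k) =
      densOfRecord₁₃ F N θ ⟨K, F.m, g₀⟩ (k + 1) :=
  (towerOfRecord₁₃Co F N θ h).inducedR_Trho ⟨K, F.m, g₀⟩ k

/-- (Co · bg-FREE PROVISO CORE) … i.e. the χ-generic β at `T := TcanOfRecord`, `χ := chiFixed29 θ.ν θ.ε₂₉` (`rfl`). [cite: Balaban1987RG1, (1.20)–(1.22) p.264, (2.9) p.266 (bookkeeping)] -/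
theorem βfun_datumOfRecord₁₃Co_eq_betaOfRecord₈Tχ (θ : Stage13Params F N) (h : θ.Provisos₁₃Core F N) :
    (datumOfRecord₁₃Co F N θ h).βfun = betaOfRecord₈Tχ F N (TcanOfRecord F N) (chiFixed29 F N θ.ν θ.ε₂₉) θ.toStage8Params := rfl

/-- (Co · bg-FREE PROVISO CORE) FACE χ ∕ actions ∕ `IndAss` ∕ `Repr`: the Stage-13 core's fields (`rfl`). [cite: Balaban1987RG1, (0.17)–(0.24) pp.255–257 (bookkeeping)] -/
theorem actionSide_stage13Co (θ : Stage13Params F N) (h : θ.Provisos₁₃Core F N) (p : B12.RunParams) (k : ℕ) :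
    ((datumOfRecord₁₃Co F N θ h).C p).χ k = (coreOfRecord₁₃Co F N θ).χ p k ∧
      ((datumOfRecord₁₃Co F N θ h).C p).effAction k = (coreOfRecord₁₃Co F N θ).effAction p k ∧
        ((datumOfRecord₁₃Co F N θ h).C p).Ek k = (coreOfRecord₁₃Co F N θ).Ek p k ∧
          (((datumOfRecord₁₃Co F N θ h).C p).IndAss k ↔ (coreOfRecord₁₃Co F N θ).IndAss p k) ∧
            (((datumOfRecord₁₃Co F N θ h).C p).Repr k ↔ (coreOfRecord₁₃Co F N θ).Repr p k) :=
  ⟨rfl, rfl, rfl, Iff.rfl, Iff.rfl⟩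

/-- (Co · bg-FREE PROVISO CORE) **FACE `Sect2Form`**: the construction's §2 [III] clause at step `k` IS the repaired §2 form of the post-𝐑 slot family of `ρ_k`, Stage 13.
[cite: Balaban1988Convergent, (2.17)–(2.18) p.257, (2.23)–(2.42) pp.258–261, Thm 1 p.262] -/
theorem sect2Form_stage13Co_iff (θ : Stage13Params F N) (h : θ.Provisos₁₃Core F N) (p : B12.RunParams) (k : ℕ) :
    ((datumOfRecord₁₃Co F N θ h).C p).Sect2Form k ↔
      HasSect2FormAEZ F N (FluctV N) p.K (settingOfRecord₁₃ F N θ p) (θ.Rz p.K) (WtOfRecord₁₃ F N θ p) k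
        (UbgOfRecord₁₃Co F N θ p k)
        (slotsOfRecord F N θ.ν θ.τ9 (EOfRecord₁₃ F N θ) (wOfRecord₉ F N θ.toStage9Params) θ.ppSel p
          (gOfRecord₁₃ F N θ p) k) :=
  sLaw₁₃Co_iff F N θ p k

/-- (Co · bg-FREE PROVISO CORE) (2.18) holds for the datum's densities with `rep_k` of record, by construction. [cite: Balaban1988Convergent, (2.18) p.257] -/
theorem holds_dens_datumOfRecord₁₃Co (θ : Stage13Params F N) (h : θ.Provisos₁₃Core F N) (K : ℕ) (g₀ : ℝ) (k : ℕ) :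
    (reprOfRecord₁₃ F N θ ⟨K, F.m, g₀⟩ k).Holds ((datumOfRecord₁₃Co F N θ h).dens K g₀ k) :=
  holds_densOfRecord₁₃ F N θ _ k

/-- (Co · bg-FREE PROVISO CORE) FACE Wilson start. [cite: Balaban1988Convergent, Thm 1 p.262] -/
theorem dens_zero_datumOfRecord₁₃Co (θ : Stage13Params F N) (h : θ.Provisos₁₃Core F N) (K : ℕ) (g₀ : ℝ) :
    (datumOfRecord₁₃Co F N θ h).dens K g₀ 0 = rhoZeroOfRecord F N K g₀ (EOfRecord₁₃ F N θ ⟨K, F.m, g₀⟩) :=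
  densOfRecord₁₃_zero F N θ ⟨K, F.m, g₀⟩

/-- (Co · bg-FREE PROVISO CORE) FACE push-forward: `𝐓ρ_k` IS an averaging-of-record image of `ρ_k` (`k < K`). [cite: Balaban1988Convergent, (3.1) p.264, (3.24)–(3.25) p.270] -/
theorem isRT_trho_datumOfRecord₁₃Co (θ : Stage13Params F N) (h : θ.Provisos₁₃Core F N) (K : ℕ) (g₀ : ℝ) (k : ℕ) (hk : k < K) :
    IsRT (avOfRecord F N K k).avg ((datumOfRecord₁₃Co F N θ h).dens K g₀ k) ((datumOfRecord₁₃Co F N θ h).real.Trho K g₀ k) :=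
  (towerOfRecord₁₃Co F N θ h).isRT_Trho ⟨K, F.m, g₀⟩ k hk

/-- (Co · bg-FREE PROVISO CORE) FACE (0.4) at the step: `∫ρ_{k+1} = ∫𝐓ρ_k` (`k < K`). [cite: Balaban1989LargeFieldI, (0.4) p.176] -/
theorem integral_dens_succ_datumOfRecord₁₃Co (θ : Stage13Params F N) (h : θ.Provisos₁₃Core F N) (K : ℕ) (g₀ : ℝ) (k : ℕ) (hk : k < K) :
    ∫ V, (datumOfRecord₁₃Co F N θ h).dens K g₀ (k + 1) V ∂fieldMeasure (F.P K) (k + 1) (SU N)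
      = ∫ V, (datumOfRecord₁₃Co F N θ h).real.Trho K g₀ k V ∂fieldMeasure (F.P K) (k + 1) (SU N) :=
  (towerOfRecord₁₃Co F N θ h).integral_succ ⟨K, F.m, g₀⟩ k hk

/-- (Co · bg-FREE PROVISO CORE) `∫ρ_k = ∫ρ₀` along every run, `k ≤ K`. [cite: Balaban1985UV3, (6) p.257] -/
theorem integral_dens_eq_zero_datumOfRecord₁₃Co (θ : Stage13Params F N) (h : θ.Provisos₁₃Core F N) (K : ℕ) (g₀ : ℝ) (k : ℕ) (hk : k ≤ K) :
    ∫ V, (datumOfRecord₁₃Co F N θ h).dens K g₀ k V ∂fieldMeasure (F.P K) k (SU N)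
      = ∫ U, (datumOfRecord₁₃Co F N θ h).dens K g₀ 0 U ∂fieldMeasure (F.P K) 0 (SU N) :=
  (towerOfRecord₁₃Co F N θ h).integral_eq_integral_zero ⟨K, F.m, g₀⟩ k hk

/-- (Co · bg-FREE PROVISO CORE) FACE integrability: every density of the datum, `k ≤ K`, is integrable. [cite: Balaban1988Convergent, (0.2) p.244 (bookkeeping)] -/
theorem integrable_dens_datumOfRecord₁₃Co (θ : Stage13Params F N) (h : θ.Provisos₁₃Core F N) (K : ℕ) (g₀ : ℝ) (k : ℕ) (hk : k ≤ K) :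
    Integrable ((datumOfRecord₁₃Co F N θ h).dens K g₀ k) (fieldMeasure (F.P K) k (SU N)) :=
  isIntegrable_towerOfRecord₁₃Co F N θ h ⟨K, F.m, g₀⟩ k hk

/-- (Co · bg-FREE PROVISO CORE) … and so is every realised `𝐓ρ_k`, `k < K`. [cite: Balaban1988Convergent, (3.25) p.270 (bookkeeping)] -/
theorem integrable_trho_datumOfRecord₁₃Co (θ : Stage13Params F N) (h : θ.Provisos₁₃Core F N) (K : ℕ) (g₀ : ℝ) (k : ℕ) (hk : k < K) :
    Integrable ((datumOfRecord₁₃Co F N θ h).real.Trho K g₀ k) (fieldMeasure (F.P K) (k + 1) (SU N)) :=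
  integrable_towerOfRecord₁₃Co_Trho F N θ h ⟨K, F.m, g₀⟩ k hk

/-- (Co · bg-FREE PROVISO CORE) The T⁴ apex at the Stage-13 datum, B1 eliminated. [cite: JaffeWittenClay2006, §6.5 p.11] -/
theorem continuumYM4Torus_datumOfRecord₁₃Co (θ : Stage13Params F N) (h : θ.Provisos₁₃Core F N)
    (hB : B16.EndStatementBPrinted (datumOfRecord₁₃Co F N θ h).C)
    (hE : EndpointExistence (datumOfRecord₁₃Co F N θ h).C.toB12)
    (hNE : T4ApexHybrid.HybridNE7Under (datumOfRecord₁₃Co F N θ h) (EndpointExistence (datumOfRecord₁₃Co F N θ h).C.toB12)) :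
    T4ContinuumYM4Torus.ContinuumYM4Torus (datumOfRecord₁₃Co F N θ h) :=
  continuumYM4Torus_datumOfTower F N _ _ hB hE hNE

/-- (Co · bg-FREE PROVISO CORE) **THE BASE HOLDS** on every run of the Stage-13 datum (`sLaw₁₃Co_zero`). [cite: Balaban1988Convergent, Thm 1 p.262; Balaban1989LargeFieldII, Thm 1 p.355 (bookkeeping)] -/
theorem sect2Form_zero_datumOfRecord₁₃Co (θ : Stage13Params F N) (h : θ.Provisos₁₃Core F N) (P : B12.RunParams) :
    ((datumOfRecord₁₃Co F N θ h).C P).Sect2Form 0 :=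
  (sect2Form_stage13Co_iff F N θ h P 0).mpr ((sLaw₁₃Co_iff F N θ P 0).mp (sLaw₁₃Co_zero F N θ P))

/-- (Co · bg-FREE PROVISO CORE) **`B16.InductionBase` AT THE STAGE-13 DATUM, for every window letter `γ`, NO hypothesis.** [cite: Balaban1988Convergent, Thm 1 p.262; Balaban1989LargeFieldII, Thm 1 p.355 + p.391] -/
theorem inductionBase_datumOfRecord₁₃Co (θ : Stage13Params F N) (h : θ.Provisos₁₃Core F N) (γ : ℝ) : B16.InductionBase (datumOfRecord₁₃Co F N θ h).C γ :=
  fun P _ => sect2Form_zero_datumOfRecord₁₃Co F N θ h P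

/-- (Co · bg-FREE PROVISO CORE) **THE STEP OF THEOREM 1 AT THE OBJECTS OF RECORD, Stage 13**: along every run in the `γ`-window, from the 𝐓-STEP LAW «`SLaw₁₃Co k → TLaw₁₃Co k`» and the 𝐑-LEAF
`ROpLeaf (VOfRecord₁₃Co θ P)`.  Both hypotheses DISPLAYED. [cite: Balaban1989LargeFieldII, Thm 1 p.355 and pp.390–391; Balaban1988Convergent, Thm p.245, Thm 2 p.263] -/
theorem inductionStep_datumOfRecord₁₃Co_of_tLaw_rOpLeaf (θ : Stage13Params F N) (h : θ.Provisos₁₃Core F N) (γ : ℝ)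
    (hT : ∀ P : B12.RunParams, ((datumOfRecord₁₃Co F N θ h).C P).flow.InInterval γ P.K →
      ∀ k, k < P.K → SLaw₁₃Co F N θ P k → TLaw₁₃Co F N θ P k)
    (hR : ∀ P : B12.RunParams, ((datumOfRecord₁₃Co F N θ h).C P).flow.InInterval γ P.K → ROpLeaf (VOfRecord₁₃Co F N θ P)) :
    B16.InductionStep (datumOfRecord₁₃Co F N θ h).C γ := by
  intro P hP k hk hS
  have hS' : SLaw₁₃Co F N θ P k := (sLaw₁₃Co_iff F N θ P k).mpr ((sect2Form_stage13Co_iff F N θ h P k).mp hS)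
  exact (sect2Form_stage13Co_iff F N θ h P (k + 1)).mpr
    ((sLaw₁₃Co_iff F N θ P (k + 1)).mp ((rOpLeaf_VOfRecord₁₃Co_iff F N θ P).mp (hR P hP) k hk (hT P hP k hk hS')))

/-- (Co · bg-FREE PROVISO CORE) **[V] THEOREM 1 AT THE STAGE-13 DATUM FROM ITS PRINTED PIECES WITHOUT A BASE HYPOTHESIS.** [cite: Balaban1989LargeFieldII, Thm 1 p.355 + p.391; Balaban1988Convergent, Thm 1 p.262, Thm p.245, Thm 2 p.263] -/
theorem thm1Printed_datumOfRecord₁₃Co_of_tLaw_rOpLeaf (θ : Stage13Params F N) (h : θ.Provisos₁₃Core F N) {γ : ℝ} (hγ : 0 < γ)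
    (hT : ∀ P : B12.RunParams, ((datumOfRecord₁₃Co F N θ h).C P).flow.InInterval γ P.K →
      ∀ k, k < P.K → SLaw₁₃Co F N θ P k → TLaw₁₃Co F N θ P k)
    (hR : ∀ P : B12.RunParams, ((datumOfRecord₁₃Co F N θ h).C P).flow.InInterval γ P.K → ROpLeaf (VOfRecord₁₃Co F N θ P)) :
    B16.Thm1Printed (datumOfRecord₁₃Co F N θ h).C :=
  B16.thm1_of_steps _ γ hγ (inductionBase_datumOfRecord₁₃Co F N θ h γ) (inductionStep_datumOfRecord₁₃Co_of_tLaw_rOpLeaf F N θ h γ hT hR)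

/-- (Co · bg-FREE PROVISO CORE) **«(D, w) is the record, Stage 13»**: admissible Stage-13 parameters SATISFYING THE STAGE-13 PROVISOS whose Stage-13 datum of record IS `D`, and a world bound
to its construction with a window `0 < w.γ ≤ θ.γ`, Bałaban's block size and the C-binding of record over the Stage-13 view. [cite: Balaban1989LargeFieldII, Thm 1 + (0.1) pp.355–356; Balaban1988Convergent, (0.2) p.244, (2.17)–(2.18) p.257, Thms 1–2 pp.262–263; Balaban1989LargeFieldI, (0.2)–(0.4) p.176; Balaban1987RG1, p.259 (objects of record; bookkeeping)] -/
def IsRecordOfRecord₁₃CCo (D : FiniteEpsData F (SU N)) (w : WorldP) : Prop :=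
  ∃ (θ : Stage13Params F N) (h : θ.Provisos₁₃Core F N), θ.Admissible F N ∧ D = datumOfRecord₁₃Co F N θ h ∧ w.C = D.C ∧ (0 < w.γ ∧ w.γ ≤ θ.γ) ∧
    w.L = (θ.L : ℝ) ∧ ∀ P : B12.RunParams, w.up P = upOfRecord₅C F N (θ.toStage5₁₃Co F N) P

/-- (Co · bg-FREE PROVISO CORE) **Pointed form**. [cite: Balaban1989LargeFieldII, Thm 1 + (0.1) pp.355–356 (bookkeeping)] -/
theorem isRecordOfRecord₁₃CCo_of_eq (θ : Stage13Params F N) (h : θ.Provisos₁₃Core F N) (hθ : θ.Admissible F N) (w : WorldP)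
    (hC : w.C = (datumOfRecord₁₃Co F N θ h).C) (hγ : 0 < w.γ ∧ w.γ ≤ θ.γ) (hL : w.L = (θ.L : ℝ))
    (hup : ∀ P, w.up P = upOfRecord₅C F N (θ.toStage5₁₃Co F N) P) :
    IsRecordOfRecord₁₃CCo F N (datumOfRecord₁₃Co F N θ h) w :=
  ⟨θ, h, hθ, rfl, hC, hγ, hL, hup⟩

/-- (Co · bg-FREE PROVISO CORE) **Every admissible Stage-12 parameter satisfying the Stage-13 provisos IS a Stage-13 record at some world**, with any window `0 < γw ≤ θ.γ`.
[cite: Balaban1989LargeFieldII, Thm 1 + (0.1) pp.355–356 (bookkeeping)] -/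
theorem exists_world_isRecordOfRecord₁₃CCo (θ : Stage13Params F N) (h : θ.Provisos₁₃Core F N) (hθ : θ.Admissible F N) {γw : ℝ} (hγw : 0 < γw ∧ γw ≤ θ.γ) :
    ∃ w : WorldP, IsRecordOfRecord₁₃CCo F N (datumOfRecord₁₃Co F N θ h) w ∧ w.γ = γw := by
  obtain ⟨w₀⟩ := nonempty_worldP
  exact ⟨{ w₀ with
      C := (datumOfRecord₁₃Co F N θ h).C, γ := γw, L := (θ.L : ℝ), one_lt_L := by exact_mod_cast θ.hL.2,
      up := fun P => upOfRecord₅C F N (θ.toStage5₁₃Co F N) P },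
    ⟨θ, h, hθ, rfl, rfl, hγw, rfl, fun _ => rfl⟩, rfl⟩

section ConsequencesCo

variable {F N}
variable {D : FiniteEpsData F (SU N)} {w : WorldP}

/-- (Co · bg-FREE PROVISO CORE) A Stage-13 record CERTIFIES its parameters' provisos and admissibility. [cite: Balaban1989LargeFieldI, (0.3)–(0.4) p.176 (bookkeeping)] -/
theorem exists_provisos_of_isRecordOfRecord₁₃CCo (h : IsRecordOfRecord₁₃CCo F N D w) :
    ∃ (θ : Stage13Params F N) (hP : θ.Provisos₁₃Core F N), θ.Admissible F N ∧ D = datumOfRecord₁₃Co F N θ hP := by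
  obtain ⟨θ, hP, hθ, hD, -⟩ := h
  exact ⟨θ, hP, hθ, hD⟩

/-- (Co · bg-FREE PROVISO CORE) Binding clause 1: the world's construction IS the datum's. [cite: Balaban1989LargeFieldII, Thm 1 p.355 (bookkeeping)] -/
theorem construction_eq_of_isRecordOfRecord₁₃CCo (h : IsRecordOfRecord₁₃CCo F N D w) : w.C = D.C := by
  obtain ⟨θ, hP, -, -, hC, -⟩ := h
  exact hC

/-- (Co · bg-FREE PROVISO CORE) Binding clause 2: the interval constant is positive. [cite: Balaban1989LargeFieldII, Thm 1 p.355 (bookkeeping)] -/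
theorem gamma_pos_of_isRecordOfRecord₁₃CCo (h : IsRecordOfRecord₁₃CCo F N D w) : 0 < w.γ := by
  obtain ⟨θ, hP, -, -, -, hγ, -⟩ := h
  exact hγ.1

/-- (Co · bg-FREE PROVISO CORE) A Stage-13 record's datum is a datum of record, Stage 0. [cite: Balaban1987RG1, (0.3)–(0.4) p.253 (bookkeeping)] -/
theorem isDatumOfRecord₀_of_isRecordOfRecord₁₃CCo (h : IsRecordOfRecord₁₃CCo F N D w) : IsDatumOfRecord₀ F N D := by
  obtain ⟨θ, hP, -, rfl, -⟩ := h
  exact isDatumOfRecord₀_datumOfRecord₁₃Co F N θ hP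

/-- (Co · bg-FREE PROVISO CORE) N23 · binder B1 at every Stage-13 record. [cite: Balaban1987RG1, (0.4) p.253] -/
theorem isPrintedAveraged_of_isRecordOfRecord₁₃CCo (h : IsRecordOfRecord₁₃CCo F N D w) : D.IsPrintedAveraged :=
  isPrintedAveraged_of_isDatumOfRecord₀ F N D (isDatumOfRecord₀_of_isRecordOfRecord₁₃CCo h)

/-- (Co · bg-FREE PROVISO CORE) **A Stage-13 record's 𝐑-leaf IS «repaired 𝐓-image form ⇒ repaired §2 form one level up» along its tower of record**, at every run.
[cite: Balaban1988Convergent, p.244, Thm 2 p.263; Balaban1989LargeFieldII, Thm 1 p.355 (bookkeeping)] -/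
theorem exists_rOperation_iff_of_isRecordOfRecord₁₃CCo (h : IsRecordOfRecord₁₃CCo F N D w) :
    ∃ (θ : Stage13Params F N) (hP : θ.Provisos₁₃Core F N), θ.Admissible F N ∧ D = datumOfRecord₁₃Co F N θ hP ∧
      ∀ P : B12.RunParams, (leavesP w P).rOperation ↔ ∀ k, k < P.K → TLaw₁₃Co F N θ P k → SLaw₁₃Co F N θ P (k + 1) := by
  obtain ⟨θ, hP, hθ, hD, -, -, -, hup⟩ := h
  refine ⟨θ, hP, hθ, hD, fun P => ?_⟩
  show (w.up P).rOperation ↔ _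
  rw [hup P]
  exact rOperation_upOfRecord₅C_stage13Co_iff F N θ P

/-- (Co · bg-FREE PROVISO CORE) **AT A STAGE-13 RECORD WHOSE 𝐑-LEAVES HOLD, EVERY `ρ_{k+1}` WHOSE `𝐓ρ_k` HAS THE 𝐓-IMAGE FORM HAS THE REPAIRED §2 FORM OF RECORD.**
[cite: Balaban1988Convergent, Thm 2 p.263, (2.18) p.257, (2.23) p.258 (bookkeeping)] -/
theorem hasSect2FormAEZ_succ_of_isRecordOfRecord₁₃CCo (h : IsRecordOfRecord₁₃CCo F N D w) (hR : ∀ P : B12.RunParams, (leavesP w P).rOperation) :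
    ∃ (θ : Stage13Params F N) (hP : θ.Provisos₁₃Core F N), θ.Admissible F N ∧ D = datumOfRecord₁₃Co F N θ hP ∧
      ∀ (P : B12.RunParams) (k : ℕ), k < P.K → TLaw₁₃Co F N θ P k →
        HasSect2FormAEZ F N (FluctV N) P.K (settingOfRecord₁₃ F N θ P) (θ.Rz P.K) (WtOfRecord₁₃ F N θ P) (k + 1)
          (UbgOfRecord₁₃Co F N θ P (k + 1))
          (slotsOfRecord F N θ.ν θ.τ9 (EOfRecord₁₃ F N θ) (wOfRecord₉ F N θ.toStage9Params) θ.ppSel P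
            (gOfRecord₁₃ F N θ P) (k + 1)) := by
  obtain ⟨θ, hP, hθ, hD, hrop⟩ := exists_rOperation_iff_of_isRecordOfRecord₁₃CCo h
  exact ⟨θ, hP, hθ, hD, fun P k hk hT => (sLaw₁₃Co_iff F N θ P (k + 1)).mp (((hrop P).mp (hR P)) k hk hT)⟩

/-- (Co · bg-FREE PROVISO CORE) **AT A STAGE-13 RECORD WHOSE 𝐑-LEAVES HOLD, [V] THEOREM 1 FOLLOWS FROM THE 𝐓-STEP LAW ALONE** (any window letter `γ > 0`).
[cite: Balaban1989LargeFieldII, Thm 1 p.355 + p.391; Balaban1988Convergent, Thm 1 p.262, Thm p.245, Thm 2 p.263 (bookkeeping)] -/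
theorem thm1Printed_of_isRecordOfRecord₁₃CCo_of_tLaw (h : IsRecordOfRecord₁₃CCo F N D w) (hR : ∀ P : B12.RunParams, (leavesP w P).rOperation) :
    ∃ (θ : Stage13Params F N) (hP : θ.Provisos₁₃Core F N), θ.Admissible F N ∧ D = datumOfRecord₁₃Co F N θ hP ∧
      ∀ γ : ℝ, 0 < γ → (∀ P : B12.RunParams, (D.C P).flow.InInterval γ P.K → ∀ k, k < P.K → SLaw₁₃Co F N θ P k → TLaw₁₃Co F N θ P k) →
        B16.Thm1Printed D.C := by
  obtain ⟨θ, hP, hθ, hD, hrop⟩ := exists_rOperation_iff_of_isRecordOfRecord₁₃CCo h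
  refine ⟨θ, hP, hθ, hD, fun γ hγ hT => ?_⟩
  subst hD
  exact thm1Printed_datumOfRecord₁₃Co_of_tLaw_rOpLeaf F N θ hP hγ hT
    (fun P _ => (rOpLeaf_VOfRecord₁₃Co_iff F N θ P).mpr ((hrop P).mp (hR P)))

end ConsequencesCo

/-- (Co · bg-FREE PROVISO CORE) **THE SHADOW RESIDUAL of `θ` under its Stage-13 provisos** (as FILE 12b: `R :=` the induced operation at the Radon–Nikodym image of the tower of record, the
format slot FROZEN at the density of record).  A PROOF DEVICE. [cite: Balaban1989LargeFieldI, (0.2)–(0.4) p.176; Balaban1987RG1, (0.13) p.254 (bookkeeping)] -/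
def shadowResidual₁₃Co (θ : Stage13Params F N) (h : θ.Provisos₁₃Core F N) : Residual₅ F N :=
  { residualOfStage13Co F N θ with
    R := fun p k => (towerOfRecord₁₃Co F N θ h).shadowR p k
    preservesIntegral_R := fun p k hk => (towerOfRecord₁₃Co F N θ h).preservesIntegral_shadowR p k hk (avOfRecord_measurable F N p.K k)
      (avOfRecord_haarAC F N p.K k hk) (isIntegrable_towerOfRecord₁₃Co F N θ h p k hk.le)
    integrable_R := fun p k hk => (towerOfRecord₁₃Co F N θ h).integrable_shadowR p k
      (isIntegrable_towerOfRecord₁₃Co F N θ h p (k + 1) (Nat.succ_le_of_lt hk))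
    S218 := fun p k _ => S218OfRecord₁₃Co F N θ p k (densOfRecord₁₃ F N θ p k) }

/-- (Co · bg-FREE PROVISO CORE) **THE SHADOW Stage-5 parameters of `θ`** at interval letter `γ'`. [cite: Balaban1989LargeFieldI, (0.2) p.176 (bookkeeping)] -/
def shadow₅OfRecord₁₃Co (θ : Stage13Params F N) (h : θ.Provisos₁₃Core F N) (γ' : ℝ) : Stage5Params F N :=
  { θ.toStage5Params with γ := γ', res := shadowResidual₁₃Co F N θ h }

/-- (Co · bg-FREE PROVISO CORE) THE KEY `rfl`: the machine of the shadow has core `coreOfRecord₁₃Co θ`. [cite: Balaban1988Convergent, (0.2) p.244 (bookkeeping)] -/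
theorem toCore_machineOfRecord₅_shadow₁₃Co (θ : Stage13Params F N) (h : θ.Provisos₁₃Core F N) (γ' : ℝ) :
    (machineOfRecord₅ F N (shadow₅OfRecord₁₃Co F N θ h γ')).toCore = coreOfRecord₁₃Co F N θ := rfl

/-- (Co · bg-FREE PROVISO CORE) The shadow's residual `R` IS the tower's shadow operation (`rfl`). [cite: Balaban1989LargeFieldI, (0.3) p.176 (bookkeeping)] -/
theorem res_R_shadow₁₃Co (θ : Stage13Params F N) (h : θ.Provisos₁₃Core F N) (γ' : ℝ) (p : B12.RunParams) (k : ℕ) :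
    (shadow₅OfRecord₁₃Co F N θ h γ').res.R p k = (towerOfRecord₁₃Co F N θ h).shadowR p k := rfl

/-- (Co · bg-FREE PROVISO CORE) The shadow is Stage-5 admissible iff `θ`'s Stage-1 dictionary is admissible and `0 < γ'`. [cite: Balaban1989LargeFieldII, Thm 1 p.355 (bookkeeping)] -/
theorem admissible_shadow₁₃Co (θ : Stage13Params F N) (h : θ.Provisos₁₃Core F N) {γ' : ℝ} (hθ : θ.Admissible F N) (hγ' : 0 < γ') :
    (shadow₅OfRecord₁₃Co F N θ h γ').Admissible :=
  ⟨hθ.1.1.1.1.1.1, hγ'⟩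

/-- (Co · bg-FREE PROVISO CORE) The shadow's upstream block IS the Stage-13 view's (`rfl`). [cite: Balaban1985UV3, Thm 1 p.257 (bookkeeping)] -/
theorem upOfRecord₅C_shadow₁₃Co (θ : Stage13Params F N) (h : θ.Provisos₁₃Core F N) (γ' : ℝ) (P : B12.RunParams) :
    upOfRecord₅C F N (shadow₅OfRecord₁₃Co F N θ h γ') P = upOfRecord₅C F N (θ.toStage5₁₃Co F N) P := rfl

/-- (Co · bg-FREE PROVISO CORE) The shadow datum has the SAME CONSTRUCTION as the Stage-13 datum. [cite: Balaban1989LargeFieldII, Thm 1 + (0.1) pp.355–356 (bookkeeping)] -/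
theorem datumOfRecord₅_shadow₁₃Co_C (θ : Stage13Params F N) (h : θ.Provisos₁₃Core F N) (γ' : ℝ) :
    (datumOfRecord₅ F N (shadow₅OfRecord₁₃Co F N θ h γ')).C = (datumOfRecord₁₃Co F N θ h).C :=
  datumOfRecord_C_eq_datumOfTower F N (machineOfRecord₅ F N (shadow₅OfRecord₁₃Co F N θ h γ')) (towerOfRecord₁₃Co F N θ h) (fun _ _ => rfl)

/-- (Co · bg-FREE PROVISO CORE) … the same densities. [cite: Balaban1988Convergent, (0.2) p.244 (bookkeeping)] -/
theorem dens_datumOfRecord₅_shadow₁₃Co (θ : Stage13Params F N) (h : θ.Provisos₁₃Core F N) (γ' : ℝ) (K : ℕ) (g₀ : ℝ) (k : ℕ) :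
    (datumOfRecord₅ F N (shadow₅OfRecord₁₃Co F N θ h γ')).dens K g₀ k = (datumOfRecord₁₃Co F N θ h).dens K g₀ k :=
  dens_datumOfRecord_eq_datumOfTower F N (machineOfRecord₅ F N (shadow₅OfRecord₁₃Co F N θ h γ')) (towerOfRecord₁₃Co F N θ h) (fun _ _ => rfl) K g₀ k

/-- (Co · bg-FREE PROVISO CORE) … the same β-functions (`rfl`). [cite: Balaban1987RG1, (1.22) p.264 (bookkeeping)] -/
theorem βfun_datumOfRecord₅_shadow₁₃Co (θ : Stage13Params F N) (h : θ.Provisos₁₃Core F N) (γ' : ℝ) :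
    (datumOfRecord₅ F N (shadow₅OfRecord₁₃Co F N θ h γ')).βfun = (datumOfRecord₁₃Co F N θ h).βfun := rfl

/-- (Co · bg-FREE PROVISO CORE) … and the same averaging maps (`rfl`). [cite: Balaban1987RG1, (0.4) p.253 (bookkeeping)] -/
theorem av_datumOfRecord₅_shadow₁₃Co (θ : Stage13Params F N) (h : θ.Provisos₁₃Core F N) (γ' : ℝ) :
    (datumOfRecord₅ F N (shadow₅OfRecord₁₃Co F N θ h γ')).av = (datumOfRecord₁₃Co F N θ h).av := rfl

/-- (Co · bg-FREE PROVISO CORE) **A STAGE-13 WORLD IS A STAGE-5 RECORD AT THE SHADOW DATUM**. [cite: Balaban1989LargeFieldII, Thm 1 + (0.1) pp.355–356 (bookkeeping)] -/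
theorem isRecordOfRecord₅C_shadow₁₃Co (θ : Stage13Params F N) (h : θ.Provisos₁₃Core F N) (hθ : θ.Admissible F N) (w : WorldP)
    (hC : w.C = (datumOfRecord₁₃Co F N θ h).C) (hγ : 0 < w.γ) (hL : w.L = (θ.L : ℝ))
    (hup : ∀ P, w.up P = upOfRecord₅C F N (θ.toStage5₁₃Co F N) P) :
    IsRecordOfRecord₅C F N (datumOfRecord₅ F N (shadow₅OfRecord₁₃Co F N θ h w.γ)) w :=
  isRecordOfRecord₅C_shadow F N (shadow₅OfRecord₁₃Co F N θ h w.γ) (admissible_shadow₁₃Co F N θ h hθ hγ) (towerOfRecord₁₃Co F N θ h)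
    (fun _ _ => rfl) w hC rfl hL hup

variable {F N}

/-- (Co · bg-FREE PROVISO CORE) **REFINEMENT `IsRecordOfRecord₁₃CCo → IsRecordOfRecord₅C` AT THE SHADOW**: every Stage-13 record's world is a Stage-5 record at a datum with THE SAME construction,
densities, β-functions and averaging maps. [cite: Balaban1989LargeFieldII, Thm 1 + (0.1) pp.355–356 (bookkeeping)] -/
theorem exists_isRecordOfRecord₅C_of_isRecordOfRecord₁₃CCo {D : FiniteEpsData F (SU N)} {w : WorldP} (h : IsRecordOfRecord₁₃CCo F N D w) :
    ∃ D₅ : FiniteEpsData F (SU N), IsRecordOfRecord₅C F N D₅ w ∧ D₅.C = D.C ∧ (∀ K g₀ k, D₅.dens K g₀ k = D.dens K g₀ k) ∧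
      D₅.βfun = D.βfun ∧ D₅.av = D.av := by
  obtain ⟨θ, hP, hθ, rfl, hC, ⟨hγ0, -⟩, hL, hup⟩ := h
  exact ⟨_, isRecordOfRecord₅C_shadow₁₃Co F N θ hP hθ w hC hγ0 hL hup, datumOfRecord₅_shadow₁₃Co_C F N θ hP w.γ,
    dens_datumOfRecord₅_shadow₁₃Co F N θ hP w.γ, rfl, rfl⟩

/-- (Co · bg-FREE PROVISO CORE) **TRANSFER**: every node statement established over the Stage-5 record predicate in the `AtRecord` shape holds at every run of every Stage-13 record's world.
[cite: Balaban1989LargeFieldII, Thm 1 p.355 (bookkeeping)] -/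
theorem atWorld_of_isRecordOfRecord₁₃CCo {X : Dag.Leaves → Prop}
    (h₅ : ∀ (D : FiniteEpsData F (SU N)) (w : WorldP), IsRecordOfRecord₅C F N D w → ∀ P : B12.RunParams, X (leavesP w P))
    {D : FiniteEpsData F (SU N)} {w : WorldP} (h : IsRecordOfRecord₁₃CCo F N D w) (P : B12.RunParams) : X (leavesP w P) := by
  obtain ⟨D₅, h5, -⟩ := exists_isRecordOfRecord₅C_of_isRecordOfRecord₁₃CCo h
  exact h₅ D₅ w h5 P

section TransferredCo

variable {D : FiniteEpsData F (SU N)} {w : WorldP}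

/-- (Co · bg-FREE PROVISO CORE) Instance · GUARDED (0.20) at every Stage-13 record. [cite: Balaban1987RG1, (0.20) p.256] -/
theorem rgFlow_of_smallCouplings_of_isRecordOfRecord₁₃CCo (h : IsRecordOfRecord₁₃CCo F N D w) (P : B12.RunParams)
    (hsc : (leavesP w P).smallCouplings) : (leavesP w P).rgFlow := by
  obtain ⟨D₅, h5, -⟩ := exists_isRecordOfRecord₅C_of_isRecordOfRecord₁₃CCo h
  exact rgFlow_of_smallCouplings_of_isRecordOfRecord₅C h5 P hsc

/-- (Co · bg-FREE PROVISO CORE) Instance · N01 `Dag.B4_main` at every run of every Stage-13 record. [cite: Balaban1983RegularityDecay, Theorem p.573 (kernel version, transferred)] -/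
theorem b4_main_of_isRecordOfRecord₁₃CCo (h : IsRecordOfRecord₁₃CCo F N D w) (P : B12.RunParams) : Dag.B4_main (leavesP w P) :=
  atWorld_of_isRecordOfRecord₁₃CCo (fun _ _ h5 P => b4_main_of_isRecordOfRecord₅C h5 P) h P

/-- (Co · bg-FREE PROVISO CORE) Instance · N02 `Dag.B5_main` at every run of every Stage-13 record. [cite: Balaban1984PropagatorsI, Props. 1.1–1.2 pp.33–36 (kernel versions, transferred)] -/
theorem b5_main_of_isRecordOfRecord₁₃CCo (h : IsRecordOfRecord₁₃CCo F N D w) (P : B12.RunParams) : Dag.B5_main (leavesP w P) :=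
  atWorld_of_isRecordOfRecord₁₃CCo (fun _ _ h5 P => b5_main_of_isRecordOfRecord₅C h5 P) h P

/-- (Co · bg-FREE PROVISO CORE) Instance · N04 `Dag.B7_main` at every run of every Stage-13 record. [cite: Balaban1985Averaging, Props. 1–10 pp.26–50 (kernel version, transferred)] -/
theorem b7_main_of_isRecordOfRecord₁₃CCo (h : IsRecordOfRecord₁₃CCo F N D w) (P : B12.RunParams) : Dag.B7_main (leavesP w P) :=
  atWorld_of_isRecordOfRecord₁₃CCo (fun _ _ h5 P => b7_main_of_isRecordOfRecord₅C h5 P) h P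

/-- (Co · bg-FREE PROVISO CORE) Instance · the END headline at a Stage-13 record needs NO `rgFlow` binder. [cite: Balaban1989LargeFieldII, Thm 1 p.355 + p.391] -/
theorem endStatementBPrinted_of_isRecordOfRecord₁₃CCo_of_nodes (h : IsRecordOfRecord₁₃CCo F N D w) {γ₀ : ℝ} (hγ₀ : w.γ ≤ γ₀)
    (hnodes : ∀ P, Nodes (leavesP w P)) (hβ : BetaBoundsInInterval w.C.toB12 γ₀ w.b w.βup) :
    B16.EndStatementBPrinted D.C := by
  obtain ⟨D₅, h5, hC5, -⟩ := exists_isRecordOfRecord₅C_of_isRecordOfRecord₁₃CCo h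
  rw [← hC5]
  exact endStatementBPrinted_of_isRecordOfRecord₅C_of_nodes h5 hγ₀ hnodes hβ

end TransferredCo

section BetaLayerCo

variable {D : FiniteEpsData F (SU N)} {w : WorldP}

variable (F N) in
/-- (Co · bg-FREE PROVISO CORE) FACE `A_{k+1}`: the core's effective action at step `k+1` IS (0.19)'s `log(𝐍_k⁻¹ · (T_k(χ_k e^{−GF∕g_k²+A_k}))(V))` with `T_k := TcanOfRecord`,
`χ_k := chiFixed29 θ.ν θ.ε₂₉` along the ₁₃ history (`rfl`) — the VALUES this record's β reads: values of a VERSION, canonical by construction, equal to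
print's point values wherever the transform's a.e.-class has a continuous representative near the point (`betaInput_eqOn_of_continuousOn₁₃`) and
nowhere asserted to be print's elsewhere. [cite: Balaban1987RG1, (0.19) p.255, p.259 (bookkeeping)] -/
theorem effAction_succ_stage13Co (θ : Stage13Params F N) (h : θ.Provisos₁₃Core F N) (p : B12.RunParams) (k : ℕ) (V : GaugeField (F.P p.K) (k + 1) (SU N)) :
    ((datumOfRecord₁₃Co F N θ h).C p).effAction (k + 1) V =
      Real.log ((normConstHT F N (TcanOfRecord F N) (chiFixed29 F N θ.ν θ.ε₂₉) p.K (gOfRecord₁₃ F N θ p) k)⁻¹ *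
        TcanOfRecord F N p.K k (integrand (chiFixed29 F N θ.ν θ.ε₂₉ p.K (gOfRecord₁₃ F N θ p) k) (gfOfRecord F N p.K k)
          (gOfRecord₁₃ F N θ p k)
          (effActionHT F N (TcanOfRecord F N) (chiFixed29 F N θ.ν θ.ε₂₉) p.K (gOfRecord₁₃ F N θ p) k)) V) := rfl

/-- (Co · bg-FREE PROVISO CORE) **A Stage-13 record's β IS the χ-generic β at the canonical-version transport and the (2.9) species at a positive threshold `ε₂₉`** (elimination face for
β-readers: NODE O, N24, N26). [cite: Balaban1987RG1, (1.20)–(1.22) p.264, (2.9) p.266, (0.13) p.254 (bookkeeping)] -/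
theorem exists_beta_of_isRecordOfRecord₁₃CCo (h : IsRecordOfRecord₁₃CCo F N D w) :
    ∃ (θ : Stage13Params F N) (hP : θ.Provisos₁₃Core F N), θ.Admissible F N ∧ D = datumOfRecord₁₃Co F N θ hP ∧
      D.βfun = betaOfRecord₈Tχ F N (TcanOfRecord F N) (chiFixed29 F N θ.ν θ.ε₂₉) θ.toStage8Params ∧ 0 < θ.ε₂₉ := by
  obtain ⟨θ, hP, hθ, hD, -⟩ := h
  exact ⟨θ, hP, hθ, hD, hD ▸ rfl, hθ.2⟩

end BetaLayerCo

end CoreRecordCo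

end Literature.MathematicalPhysics.QuantumFieldTheory.Balaban1983to89.Node00

end
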